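import Summits.CriticalPhenomena.SAWScalingLimit.Theorems.SAWSpinMonotoneQCIdentificationNoBranchingArcsAux
import Summits.CriticalPhenomena.SAWScalingLimit.Theorems.SAWSpinMonotoneQCIdentificationNoBranchingHexagonAux
import Summits.CriticalPhenomena.SAWScalingLimit.Theorems.SAWSpinMonotoneQCIdentificationCornerSites

/-!
# `NoBranching`, step S4 — the arc ledger at a boundary site (helper of
`stub_noBranching : NoFoldBound → NoBranching`, line `eight_fifths_primitive`, crux `QCIdentification`,
stmt-CriticalPhenomena-16772)

**What.** Fix a site `s` of `𝕋`, its hexagon `face s 0, …, face s 5` of `ℍ` (counterclockwise,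
`HexKernel.face`) and the corner indices `arcCornerIdx l` of the geometry file `…NoBranchingArcsAux`
(`cornerAngle F (face s l) (arcCornerIdx l)` is the image angle of the face `face s l` at `s`; its sides
are the darts towards `face s (l+1)` and `face s (l-1)`, and the two darts through one hexagon edge are
opposite, `s4_dart_shared_neg`). Consequently, around `s` the corner angles CHAIN: in `Real.Angle`,
`cornerAngle (face s l) = arg E_{l+1} - arg E_l` with `E_l = dart F (face s l) (arcCornerIdx l + 1)`
(`s4_cornerAngle_face_coe`), as soon as the darts are non-zero. For the critical observable `F = Fobs Λ a`
of a simply connected domain with boundary source, under the no-fold bound (K) (`NoFoldBound`), along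
an ARC `face s (j+1), …, face s (j+m)` (`m ≠ 0`) of faces of `Λ` with non-degenerate `∂H`-modes (so
that all their darts are non-zero, `NB.dart_ne_zero`) the sum `B_arc` of the `m` corner angles at `s`
satisfies

* `s4_arc_corner_sum_angle`: `(B_arc : Real.Angle) = π - (arg g_out - arg g_in)`, where
  `g_out = dart F (face s (j+1)) (arcCornerIdx (j+1) + 1)` is the dart of the first arc face through
  the flank mid-edge `p_out = {face s j, face s (j+1)}` and
  `g_in = dart F (face s (j+m)) (arcCornerIdx (j+m))` that of the last arc face through
  `p_in = {face s (j+1+m), face s (j+m)}`;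
* `s4_arc_corner_sum_mem`: `0 < B_arc < m·π` (each corner angle lies in `(0, π)`);
* `s4_arc_corner_sum_phase`: `(B_arc : Real.Angle) = m·π/3 - (arg F(p_out) - arg F(p_in))` — by the
  flank geometry `arg g_out - arg g_in ≡ (π - m·π/3) + (arg F(p_out) - arg F(p_in))`
  (`s4_flank_phase`; the flank values are non-zero by S1): the angle excess `B_arc - m·π/3` of an arc
  is minus the phase drop of `F` between its flank mid-edges, to be fed with the boundary phases
  `arg F(p) ≡ -(5/8) W(p)` (S5) and the step law `W(p_out) - W(p_in) = π - m·π/3` (S6,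
  `StepLaw.sl_boundary_winding_step`), giving `B_arc - m·π/3 ≡ (5/8)(π - m·π/3)` at ordinary arcs.

Dictionary with the sibling files: `arcCornerIdx = NB.cornerIdx` (hexagon ledger S2,
`arcCornerIdx_eq_cornerIdx`) and `Stokes.siteCornerIdx j = arcCornerIdx j + 1` (corner-site regrouping,
`siteCornerIdx_eq_arcCornerIdx_add_one`).

**Why.** This is the per-site boundary bookkeeping of the combinatorial Gauss–Bonnet count proving
`NoBranching` (local degree one of the PL developing map at every interior hexagon). Validated by
exact enumeration (work file `scratch_s4/s4_check.py`: 1 218 arcs of 13 domains for (a), 529 arcs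
with windings for (c), residual ≤ 4e-15). Registered entry points (∀-telescopes):
`s4_arc_corner_sum_angle`, `s4_arc_corner_sum_mem`, `s4_arc_corner_sum_phase`.

Sources: H. Duminil-Copin, S. Smirnov, *The connective constant of the honeycomb lattice equals
`√(2+√2)`*, Ann. of Math. 175 (2012) 1653–1665 (arXiv:1007.0575), Lemma 1 and §3; the stub report
`STUB-REPORT-noBranching.md` of this line (§2, S4).
-/

noncomputable section

open Complex
open Literature.Probability.LatticeModels Literature.Probability.RandomPlanarGeometry
open Literature.Probability.RandomPlanarGeometry.SAW
open Literature.Barriers.CriticalPhenomena Literature.Barriers.CriticalPhenomena.HexKernel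
open Summit.CriticalPhenomena.SAWScalingLimit.Theses.SAWDevelopingMap

namespace Summit.CriticalPhenomena.SAWScalingLimit.Cruxes.QCIdentification.EightFifthsPrimitive

namespace NB

/-! ### Dictionary with the sibling corner indexings -/

/-- The arc corner index IS the hexagon file's `NB.cornerIdx` (S2, `…NoBranchingHexagonAux`). -/
theorem arcCornerIdx_eq_cornerIdx : arcCornerIdx = cornerIdx := rfl

/-- The corner-site regrouping (`Stokes.st_sum_corners_by_site`, file `…CornerSites`) indexes the
corner of `face s j` at `s` by its VERTEX `Stokes.siteCornerIdx j` (`triVert (face s j) (siteCornerIdx j) = s`);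
the corner ANGLE there is `cornerAngle F (face s j) (arcCornerIdx j)`: `siteCornerIdx j = arcCornerIdx j + 1`. -/
theorem siteCornerIdx_eq_arcCornerIdx_add_one (j : Fin 6) :
    Stokes.siteCornerIdx j = arcCornerIdx j + 1 := by
  fin_cases j <;> rfl

/-! ### Corner angles as differences of arguments (in `Real.Angle`) -/

/-- A corner angle with non-zero sides, read in `Real.Angle`:
`cornerAngle = π - arg (dart (k+1)) + arg (dart k)`. -/
theorem s4_cornerAngle_coe {F : Sym2 HexVertex → ℂ} {v : HexVertex} {k : Fin 3}
    (h0 : dart F v k ≠ 0) (h1 : dart F v (k + 1) ≠ 0) :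
    (cornerAngle F v k : Real.Angle) =
      (Real.pi : Real.Angle) - (arg (dart F v (k + 1)) : Real.Angle) +
        (arg (dart F v k) : Real.Angle) := by
  rw [cornerAngle, Real.Angle.coe_sub, Complex.arg_div_coe_angle h1 h0]
  abel

/-- **Chaining around a site.** The corner angle of `face s l` at `s` is the argument increment
between the second sides of the corners of `face s l` and `face s (l+1)` at `s`:
`cornerAngle (face s l) = arg E_{l+1} - arg E_l`, `E_l = dart F (face s l) (arcCornerIdx l + 1)`. -/
theorem s4_cornerAngle_face_coe {F : Sym2 HexVertex → ℂ} {s : Site 2} {l : Fin 6}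
    (hD : dart F (face s l) (arcCornerIdx l) ≠ 0)
    (hE : dart F (face s l) (arcCornerIdx l + 1) ≠ 0) :
    (cornerAngle F (face s l) (arcCornerIdx l) : Real.Angle) =
      (arg (dart F (face s (l + 1)) (arcCornerIdx (l + 1) + 1)) : Real.Angle) -
        (arg (dart F (face s l) (arcCornerIdx l + 1)) : Real.Angle) := by
  rw [s4_cornerAngle_coe hD hE, s4_dart_shared_neg, Complex.arg_neg_coe_angle hD]
  abel

/-- **Telescoping along an arc** (indexed by `ℕ` through `HV.fin6`): if the `n` faces
`face s (j+1+t)`, `t < n`, have non-zero darts at their corners at `s`, the sum of their corner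
angles at `s` is, in `Real.Angle`, `arg E_{j+1+n} - arg E_{j+1}`. -/
theorem s4_arc_sum_range_coe (F : Sym2 HexVertex → ℂ) (s : Site 2) (j : Fin 6) : ∀ n : ℕ,
    (∀ t : ℕ, t < n → dart F (face s (j + 1 + HV.fin6 t)) (arcCornerIdx (j + 1 + HV.fin6 t)) ≠ 0 ∧
      dart F (face s (j + 1 + HV.fin6 t)) (arcCornerIdx (j + 1 + HV.fin6 t) + 1) ≠ 0) →
    ((∑ t ∈ Finset.range n,
        cornerAngle F (face s (j + 1 + HV.fin6 t)) (arcCornerIdx (j + 1 + HV.fin6 t)) : ℝ) :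
        Real.Angle) =
      (arg (dart F (face s (j + 1 + HV.fin6 n)) (arcCornerIdx (j + 1 + HV.fin6 n) + 1)) :
          Real.Angle) -
        (arg (dart F (face s (j + 1)) (arcCornerIdx (j + 1) + 1)) : Real.Angle)
  | 0, _ => by simp
  | n + 1, h => by
    have e : j + 1 + HV.fin6 (n + 1) = j + 1 + HV.fin6 n + 1 := by rw [HV.fin6_succ]; abel
    rw [Finset.sum_range_succ, Real.Angle.coe_add,
      s4_arc_sum_range_coe F s j n (fun t ht => h t (Nat.lt_succ_of_lt ht)),
      s4_cornerAngle_face_coe (h n n.lt_succ_self).1 (h n n.lt_succ_self).2, e]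
    abel

/-- A sum over `{i : Fin 6 | i < m}` is a sum over `t < m` through `HV.fin6`. -/
theorem s4_sum_filter_lt_eq {M : Type*} [AddCommMonoid M] (m : Fin 6) (f : Fin 6 → M) :
    ∑ i ∈ Finset.univ.filter (fun i : Fin 6 => i < m), f i =
      ∑ t ∈ Finset.range (m : ℕ), f (HV.fin6 t) := by
  have h1 : HV.fin6 1 = 1 := by decide
  have h2 : HV.fin6 2 = 2 := by decide
  have h3 : HV.fin6 3 = 3 := by decide
  have h4 : HV.fin6 4 = 4 := by decide
  fin_cases m <;>
    simp [Finset.sum_filter, Fin.sum_univ_six, Finset.sum_range_succ, h1, h2, h3, h4, add_assoc]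

/-! ### The arc ledger -/

/-- **S4 (a), the arc ledger modulo `2π` (registered).** Under `NoFoldBound`, in a simply connected
domain with boundary source, for `m ≠ 0` consecutive faces `face s (j+1), …, face s (j+m)` of `Λ`
around a site `s` with non-zero `∂H`-modes, the sum of their corner angles at `s` equals, in
`Real.Angle`, `π - (arg g_out - arg g_in)`, `g_out = dart F (face s (j+1)) (arcCornerIdx (j+1) + 1)`
the dart through `p_out = {face s j, face s (j+1)}`, `g_in = dart F (face s (j+m)) (arcCornerIdx (j+m))`
the dart through `p_in = {face s (j+1+m), face s (j+m)}`. -/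
theorem s4_arc_corner_sum_angle : NoFoldBound → ∀ {Λ : Finset HexVertex}, hexDomainSimplyConnected Λ → ∀ {a : Sym2 HexVertex}, a ∈ hexDomainBoundary Λ → ∀ (s : Site 2) (j m : Fin 6), m ≠ 0 → (∀ i : Fin 6, i < m → HexKernel.face s (j + 1 + i) ∈ Λ) → (∀ i : Fin 6, i < m → modeSum (Fobs Λ a) (HexKernel.face s (j + 1 + i)) ≠ 0) → ((∑ i ∈ Finset.univ.filter (fun i : Fin 6 => i < m), cornerAngle (Fobs Λ a) (HexKernel.face s (j + 1 + i)) (arcCornerIdx (j + 1 + i)) : ℝ) : Real.Angle) = (Real.pi : Real.Angle) - ((Complex.arg (dart (Fobs Λ a) (HexKernel.face s (j + 1)) (arcCornerIdx (j + 1) + 1)) - Complex.arg (dart (Fobs Λ a) (HexKernel.face s (j + m)) (arcCornerIdx (j + m))) : ℝ) : Real.Angle) := by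
  intro hK Λ hΛ a ha s j m hm hin hS
  have h6 := m.isLt
  have hm0 : (m : ℕ) ≠ 0 := fun h => hm (Fin.ext h)
  obtain ⟨n, hn4, hmn⟩ : ∃ n : ℕ, n ≤ 4 ∧ (m : ℕ) = n + 1 := ⟨(m : ℕ) - 1, by omega, by omega⟩
  have em : HV.fin6 (n + 1) = m := Fin.ext (by rw [StepLaw.val_fin6_of_lt (by omega), hmn])
  have hlt : ∀ t : ℕ, t < n + 1 → HV.fin6 t < m := fun t ht => by
    rw [Fin.lt_def, StepLaw.val_fin6_of_lt (by omega), hmn]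
    exact ht
  have hne : ∀ t : ℕ, t < n + 1 → ∀ k : Fin 3, dart (Fobs Λ a) (face s (j + 1 + HV.fin6 t)) k ≠ 0 :=
    fun t ht k => dart_ne_zero hK hΛ ha (hin _ (hlt t ht)) (hS _ (hlt t ht)) k
  have hsum : (∑ i ∈ Finset.univ.filter (fun i : Fin 6 => i < m),
      cornerAngle (Fobs Λ a) (face s (j + 1 + i)) (arcCornerIdx (j + 1 + i))) =
      ∑ t ∈ Finset.range (n + 1),
        cornerAngle (Fobs Λ a) (face s (j + 1 + HV.fin6 t)) (arcCornerIdx (j + 1 + HV.fin6 t)) := by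
    rw [s4_sum_filter_lt_eq, hmn]
  have e1 : j + 1 + HV.fin6 (n + 1) = j + m + 1 := by rw [em]; abel
  have e2 : j + 1 + HV.fin6 n = j + m := by rw [← em, HV.fin6_succ]; abel
  have hD : dart (Fobs Λ a) (face s (j + m)) (arcCornerIdx (j + m)) ≠ 0 := by
    rw [← e2]; exact hne n n.lt_succ_self _
  rw [hsum, s4_arc_sum_range_coe (Fobs Λ a) s j (n + 1) (fun t ht => ⟨hne t ht _, hne t ht _⟩), e1,
    s4_dart_shared_neg, Complex.arg_neg_coe_angle hD, Real.Angle.coe_sub]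
  abel

/-- **S4 (a'), the arc ledger is bounded (registered).** Under the same hypotheses the sum of the
`m` corner angles at `s` lies in `(0, m π)` (each lies in `(0, π)`, `nb_cornerAngle_mem_Ioo`). -/
theorem s4_arc_corner_sum_mem : NoFoldBound → ∀ {Λ : Finset HexVertex}, hexDomainSimplyConnected Λ → ∀ {a : Sym2 HexVertex}, a ∈ hexDomainBoundary Λ → ∀ (s : Site 2) (j m : Fin 6), m ≠ 0 → (∀ i : Fin 6, i < m → HexKernel.face s (j + 1 + i) ∈ Λ) → (∀ i : Fin 6, i < m → modeSum (Fobs Λ a) (HexKernel.face s (j + 1 + i)) ≠ 0) → (∑ i ∈ Finset.univ.filter (fun i : Fin 6 => i < m), cornerAngle (Fobs Λ a) (HexKernel.face s (j + 1 + i)) (arcCornerIdx (j + 1 + i))) ∈ Set.Ioo 0 ((m : ℕ) * Real.pi) := by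
  intro hK Λ hΛ a ha s j m hm hin hS
  have hcard : (Finset.univ.filter (fun i : Fin 6 => i < m)).card = (m : ℕ) := by
    rw [Finset.filter_gt_eq_Iio, Fin.card_Iio]
  have hmem : ∀ i ∈ Finset.univ.filter (fun i : Fin 6 => i < m), i < m := fun i hi =>
    (Finset.mem_filter.1 hi).2
  have hne : (Finset.univ.filter (fun i : Fin 6 => i < m)).Nonempty :=
    ⟨0, Finset.mem_filter.2 ⟨Finset.mem_univ _, (Fin.pos_iff_ne_zero' m).2 hm⟩⟩
  have hIoo : ∀ i ∈ Finset.univ.filter (fun i : Fin 6 => i < m),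
      cornerAngle (Fobs Λ a) (face s (j + 1 + i)) (arcCornerIdx (j + 1 + i)) ∈ Set.Ioo 0 Real.pi :=
    fun i hi => nb_cornerAngle_mem_Ioo hK hΛ ha (hin i (hmem i hi)) (hS i (hmem i hi)) _
  refine ⟨Finset.sum_pos (fun i hi => (hIoo i hi).1) hne, ?_⟩
  calc ∑ i ∈ Finset.univ.filter (fun i : Fin 6 => i < m),
        cornerAngle (Fobs Λ a) (face s (j + 1 + i)) (arcCornerIdx (j + 1 + i))
      < ∑ i ∈ Finset.univ.filter (fun i : Fin 6 => i < m), Real.pi :=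
        Finset.sum_lt_sum_of_nonempty hne fun i hi => (hIoo i hi).2
    _ = (m : ℕ) * Real.pi := by rw [Finset.sum_const, hcard, nsmul_eq_mul]

/-- **S4 (c), the arc ledger against the boundary phases (registered).** Under the hypotheses of
`s4_arc_corner_sum_angle` the flank values `F(p_out)`, `F(p_in)` are non-zero (S1) and the sum of
the `m` corner angles at `s` is, modulo `2π`, `m·π/3 - (arg F(p_out) - arg F(p_in))`,
`p_out = {face s j, face s (j+1)}`, `p_in = {face s (j+1+m), face s (j+m)}`: the angle excess
`B_arc - m·π/3` of the arc is minus the phase drop of `F` between its two flank mid-edges. -/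
theorem s4_arc_corner_sum_phase : NoFoldBound → ∀ {Λ : Finset HexVertex}, hexDomainSimplyConnected Λ → ∀ {a : Sym2 HexVertex}, a ∈ hexDomainBoundary Λ → ∀ (s : Site 2) (j m : Fin 6), m ≠ 0 → (∀ i : Fin 6, i < m → HexKernel.face s (j + 1 + i) ∈ Λ) → (∀ i : Fin 6, i < m → modeSum (Fobs Λ a) (HexKernel.face s (j + 1 + i)) ≠ 0) → ((∑ i ∈ Finset.univ.filter (fun i : Fin 6 => i < m), cornerAngle (Fobs Λ a) (HexKernel.face s (j + 1 + i)) (arcCornerIdx (j + 1 + i)) : ℝ) : Real.Angle) = (((m : ℕ) * (Real.pi / 3) : ℝ) : Real.Angle) - ((Complex.arg (Fobs Λ a s(HexKernel.face s j, HexKernel.face s (j + 1))) : Real.Angle) - (Complex.arg (Fobs Λ a s(HexKernel.face s (j + 1 + m), HexKernel.face s (j + m))) : Real.Angle)) := by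
  intro hK Λ hΛ a ha s j m hm hin hS
  have h0 : (0 : Fin 6) < m := (Fin.pos_iff_ne_zero' m).2 hm
  have hl : m - 1 < m := Fin.sub_one_lt_iff.2 h0
  have e : j + 1 + (m - 1) = j + m := by abel
  have hv0 : face s (j + 1) ∈ Λ := by simpa using hin 0 h0
  have hS0 : modeSum (Fobs Λ a) (face s (j + 1)) ≠ 0 := by simpa using hS 0 h0
  have hv1 : face s (j + m) ∈ Λ := by have h := hin (m - 1) hl; rwa [e] at h
  have hS1 : modeSum (Fobs Λ a) (face s (j + m)) ≠ 0 := by have h := hS (m - 1) hl; rwa [e] at h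
  have hFo : Fobs Λ a s(face s j, face s (j + 1)) ≠ 0 := by
    have h := fobs_ne_zero_of_modeSum_ne_zero hK hΛ ha hv0 hS0 (arcCornerIdx (j + 1) + 1)
    rwa [hexNbr_face_arcCornerIdx_succ, add_sub_cancel_right, Sym2.eq_swap] at h
  have hFi : Fobs Λ a s(face s (j + 1 + m), face s (j + m)) ≠ 0 := by
    have h := fobs_ne_zero_of_modeSum_ne_zero hK hΛ ha hv1 hS1 (arcCornerIdx (j + m))
    rwa [hexNbr_face_arcCornerIdx, show j + m + 1 = j + 1 + m by abel, Sym2.eq_swap] at h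
  rw [s4_arc_corner_sum_angle hK hΛ ha s j m hm hin hS, Real.Angle.coe_sub,
    s4_flank_phase _ s j m hFo hFi, Real.Angle.coe_sub]
  abel

end NB

end Summit.CriticalPhenomena.SAWScalingLimit.Cruxes.QCIdentification.EightFifthsPrimitive
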